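import Summits.HodgeConjecture.HodgeConjecture.Theorems.R90S6BCLineSymm   -- ★ W7-b (i) (p09): the `GL₃` template + `polynomial_eq_of_forall_eval_add_inv_eq`
import HarnessLib

/-!
# R90 · S6 «Ch. 14.1–14.5 stable TF» — W10-a (E.5), rank 2, part 1: the TWISTED line `z ↦ (z, z⁻¹)` of `GL₂` — every `S₂`-invariant
# Laurent polynomial, hence every unramified Hecke eigen-polynomial of `GL₂`, is EVEN on it: `P(z, z⁻¹) = Q(z + z⁻¹)` for a unique
# `Q ∈ ℂ[X]` (`Theorems/R90S6LineSymmTwo.lean`)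

Cell `hodgecm-mathlib`, crux H413 (`stmt-HodgeConjecture-24833`), route of record `HCCMUnconditional`; programme R90-TF, section S6
(base `R90-C14`), seat R90-C14-p02 (g2); card W10-a (E.5) «RANK-2 η̂-GRAPH» (S6 dealer R90-C14-plan (g2) 2026-09-05T00:09:50Z ruling R3;
census R90-C14-p06 (g0) l.5973 (C)(E.5); DAG r5 row E1.4.4.1.2 «η̂-maps in graph currency»).  Helper lane `--supports stmt-HodgeConjecture-24833
--as helper`; THEOREMS ONLY (no definition, no instance, no notation, no named fact, no `sorry`); the `Fin 2` twin of ★ p09's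
`Theorems/R90S6BCLineSymm.lean` (cited by import, `polynomial_eq_of_forall_eval_add_inv_eq` reused BY NAME).

THE PRINT [Rogawski1990, §4.11 pp. 58–59]: `G = U(2)` (quasi-split, the tree's `U(Φ₂) = U(σ, antidiag(1,1))`), `G̃ = Res_{E∕F} G`, `G̃_v = GL₂(E_w)`
at an inert unramified `w`; Prop. 4.11.1 (c): `π̃ = i_{G̃}(χ ∘ N)` corresponds to `i_G(χ)` under `η̂₁` (and to `i_G(χμ⁻¹)` under `η̂₂`); for the
unramified character `χ_z` (`χ_z(d(a, ā⁻¹)) = z^{val a}`, Satake parameter `(z, 1)` of `U(2)`) the character `χ_z ∘ N` of the diagonal torus of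
`GL₂(E_w)` is `d(x, y) ↦ z^{val x − val y}` — Satake parameter `(z, z⁻¹)`: the TWISTED LINE of `GL₂`.  Hence the rank-2 η̂-graph of record
`GraphEta₁² φ₂ f :⟺ ∀ z, λ^{GL₂}_{(z,z⁻¹)}(φ₂) = λ^{U(J₀,2)}_{(z,1)}(f)` (ruling R2; at an inert place with `μ_w` unramified `η̂₂ ≡ η̂₁` on
spherical algebras since `det ∈ E¹_w ⊂ 𝒪_w^×`).  [CartierCorvallis1979, §IV Thm. 4.1, §IV.2]: the `δ^{1∕2}`-normalised Satake transform of `GL₂`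
is onto `ℂ[ℤ²]^{S₂} = ℂ[e_1, e_2, e_2⁻¹]`.

WHAT IS PROVED (part 1 = the `GL₂`-side evenness; part 2 `Theorems/R90S6EtaGraphTwoPartner.lean` builds `η̂` as an algebra hom):
* §1 `laurentEvalAt_lineTwo_single` (`x^m ↦ z^{m₀ − m₁}` on the line), the two subsets-of-`Fin 2` enumerations, and the generator values
  `e_1(z, z⁻¹) = z + z⁻¹`, `e_2(z, z⁻¹) = 1` (`laurentEvalAt_lineTwo_esymm_one∕two`).
* §2 **`symmLaurent_line_even_two`**: for `P ∈ ℂ[ℤ²]^{S₂}` (`weylInvariants ℂ (Fin 2 → ℤ) (glWeylGroup 2)`) there is `Q ∈ ℂ[X]` with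
  `P(z, z⁻¹) = Q(z + z⁻¹)` for all `z ∈ ℂˣ` (`Algebra.adjoin_induction` over ★ `weylInvariants_glWeylGroup_eq_adjoin`; the generator `x^{−𝟙}`
  takes the value `1`); uniqueness `symmLaurent_line_existsUnique_two` (★ `polynomial_eq_of_forall_eval_add_inv_eq`); evenness
  `laurentEvalAt_lineTwo_inv` (`P(z⁻¹, z) = P(z, z⁻¹)`, the transposition `(0 1) = S₂`).
* §3 **`glTwoHeckeEigenpoly_line_even`** (+ `_existsUnique`, `glTwoHeckeEigencharacter_line_inv`): for ANY field `K` with a DVR valuation ring,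
  finite residue field `q`, uniformizer `ϖ`, a unit square root `u` of `q` and the `δ_B^{1∕2}` weight `wt(e) = u^{|e| − 2⟨ν, e⟩}` (hypothesis `hwt`,
  verbatim the spec of ★ `satakeTransform_deltaHalf_mem_weylInvariants (n := 2)`; the `GL₃` letters of ★ p09 at `n = 2`), every
  `φ ∈ ℋ(GL₂(K), GL₂(𝒪))` has `λ_{(z,z⁻¹)}(φ) = Q_φ(z + z⁻¹)`.
HONEST LABEL: local spherical Hecke-algebra bookkeeping (the `GL₂`-side eigen-polynomial on the twisted line); proves no printed global
statement, discharges no citation; count-neutral helper until E1.4.4.3.x ∕ E1.4.4.5b consume the rank-2 η̂-graph.  HC_CM is proved only modulo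
the 7 printed citations (2 remaining named inputs: hLiu418 = stmt-HodgeConjecture-24832, h413 = stmt-HodgeConjecture-24833) until rung 0 closes;
REL ≠ ★ ≠ BUILT.

## Tree search
★ `weylInvariants_glWeylGroup_eq_adjoin` [GLnHeckeSphericalMapImage.lean:123] (generic `n`), ★ `satakeTransform_deltaHalf_mem_weylInvariants`
[SatakeIsomorphismGLNormalisations.lean:305] (generic `n`), ★ `laurentEvalAt_single` [SphericalHeckeEigenvaluesGL.lean:88], ★ p09
`polynomial_eq_of_forall_eval_add_inv_eq` ∕ `symmLaurent_bcLine_even` [Theorems/R90S6BCLineSymm.lean:182 :161] (the `Fin 3` twin), ★ p03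
`hecke_eigenpoly_two_symmetric` (the `U(2)` side).  Dedup: `lean search "lineTwo|line_even_two|glTwoHeckeEigenpoly"` — no hit.

## References
* [Rogawski1990] J. D. Rogawski, *Automorphic Representations of Unitary Groups in Three Variables*, Ann. of Math. Stud. 123 (1990),
  §4.11 Prop. 4.11.1 pp. 58–59; §4.10 Prop. 4.10.2 p. 58 (the pattern at rank 3).
* [CartierCorvallis1979] P. Cartier, *Representations of 𝔭-adic groups: a survey*, PSPM 33.1 (1979), §IV (4.2)–(4.4), Thm. 4.1,
  Cor. 4.2, §IV.2 Example.
* [AndrianovZhuravlev2015] A. N. Andrianov, V. G. Zhuravlev, *Modular Forms and Hecke Operators*, Ch. 3 §2.3 Thm. 2.20.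
-/

set_option autoImplicit false
-- the mandated namespace repeats the single-problem summit's segment (`HodgeConjecture.HodgeConjecture`)
set_option linter.dupNamespace false

noncomputable section

open Polynomial
open Literature.NumberTheory.Automorphic

namespace Summit.HodgeConjecture.HodgeConjecture.R90.S6

/-! ## §1 Evaluation on the twisted line `(z, z⁻¹)` -/

/-- On the twisted line the monomial `c·x^m` takes the value `c · z^{m₀ − m₁}`. [folklore] -/
theorem laurentEvalAt_lineTwo_single (z : ℂˣ) (m : Fin 2 → ℤ) (c : ℂ) :
    laurentEvalAt ![z, z⁻¹] (AddMonoidAlgebra.single m c) = c * (z : ℂ) ^ (m 0 - m 1) := by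
  rw [laurentEvalAt_single, Fin.prod_univ_two]
  simp only [Matrix.cons_val_zero, Matrix.cons_val_one, Units.val_inv_eq_inv_val, inv_zpow',
    zpow_sub₀ (Units.ne_zero z), div_eq_mul_inv, zpow_neg]

/-- `powersetCard 1` of `Fin 2`. [folklore] -/
theorem powersetCard_one_univ_fin_two :
    Finset.powersetCard 1 (Finset.univ : Finset (Fin 2)) = {{0}, {1}} := by
  decide

/-- `powersetCard 2` of `Fin 2`. [folklore] -/
theorem powersetCard_two_univ_fin_two :
    Finset.powersetCard 2 (Finset.univ : Finset (Fin 2)) = {{0, 1}} := by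
  decide

/-- The indicator monomial `x^{𝟙_t}` takes the value `z^{[0 ∈ t] − [1 ∈ t]}` on the twisted line. [folklore] -/
theorem laurentEvalAt_lineTwo_single_indicator (z : ℂˣ) (t : Finset (Fin 2)) :
    laurentEvalAt ![z, z⁻¹] (AddMonoidAlgebra.single (fun i => if i ∈ t then (1 : ℤ) else 0) (1 : ℂ)) =
      (z : ℂ) ^ ((if (0 : Fin 2) ∈ t then (1 : ℤ) else 0) - (if (1 : Fin 2) ∈ t then (1 : ℤ) else 0)) := by
  rw [laurentEvalAt_lineTwo_single, one_mul]

/-- `e_1(z, z⁻¹) = z + z⁻¹`. [folklore] -/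
theorem laurentEvalAt_lineTwo_esymm_one (z : ℂˣ) :
    laurentEvalAt ![z, z⁻¹] (∑ t ∈ Finset.powersetCard 1 (Finset.univ : Finset (Fin 2)),
        AddMonoidAlgebra.single (fun i => if i ∈ t then (1 : ℤ) else 0) (1 : ℂ)) = (z : ℂ) + (z : ℂ)⁻¹ := by
  have h1 : ({0} : Finset (Fin 2)) ∉ ({{1}} : Finset (Finset (Fin 2))) := by decide
  rw [powersetCard_one_univ_fin_two, map_sum, Finset.sum_insert h1, Finset.sum_singleton,
    laurentEvalAt_lineTwo_single_indicator, laurentEvalAt_lineTwo_single_indicator]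
  simp only [Finset.mem_singleton, Fin.isValue, show (0 : Fin 2) ≠ 1 by decide, show (1 : Fin 2) ≠ 0 by decide,
    if_true, if_false, sub_zero, zero_sub, zpow_one, zpow_neg]

/-- `e_2(z, z⁻¹) = 1`. [folklore] -/
theorem laurentEvalAt_lineTwo_esymm_two (z : ℂˣ) :
    laurentEvalAt ![z, z⁻¹] (∑ t ∈ Finset.powersetCard 2 (Finset.univ : Finset (Fin 2)),
        AddMonoidAlgebra.single (fun i => if i ∈ t then (1 : ℤ) else 0) (1 : ℂ)) = 1 := by
  rw [powersetCard_two_univ_fin_two, map_sum, Finset.sum_singleton, laurentEvalAt_lineTwo_single_indicator]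
  simp only [Finset.mem_insert, Finset.mem_singleton, Fin.isValue, show (0 : Fin 2) ≠ 1 by decide,
    show (1 : Fin 2) ≠ 0 by decide, if_true, or_true, true_or, sub_self, zpow_zero]

/-- **`e_r(z, z⁻¹)`**: the elementary symmetric Laurent polynomials `e_1, e_2` of `GL₂` take the values `z + z⁻¹`, `1` on the twisted
line — each a polynomial in `z + z⁻¹`. [folklore] -/
theorem exists_polynomial_laurentEvalAt_lineTwo_esymm (r : Fin 2) :
    ∃ Q : ℂ[X], ∀ z : ℂˣ,
      laurentEvalAt ![z, z⁻¹] (∑ t ∈ Finset.powersetCard ((r : ℕ) + 1) (Finset.univ : Finset (Fin 2)),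
          AddMonoidAlgebra.single (fun i => if i ∈ t then (1 : ℤ) else 0) (1 : ℂ)) = Q.eval ((z : ℂ) + (z : ℂ)⁻¹) := by
  fin_cases r
  · exact ⟨X, fun z => by rw [eval_X]; exact laurentEvalAt_lineTwo_esymm_one z⟩
  · exact ⟨1, fun z => by rw [eval_one]; exact laurentEvalAt_lineTwo_esymm_two z⟩

/-! ## §2 `S₂`-invariant Laurent polynomials are even on the twisted line: `P(z, z⁻¹) = Q(z + z⁻¹)` -/

/-- **W10-a (E.5) `symmLaurent_line_even_two` — every symmetric Laurent polynomial in two variables is a polynomial in `z + z⁻¹`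
on the twisted line.**  For `P ∈ ℂ[ℤ²]^{S₂}` (`weylInvariants`, the currency of the `δ^{1∕2}`-normalised `GL₂` Satake transform) there is
`Q ∈ ℂ[X]` with `P(z, z⁻¹) = Q(z + z⁻¹)` for every `z ∈ ℂˣ`.  Proof: `ℂ[ℤ²]^{S₂} = ℂ[e_1, e_2, (x₁x₂)⁻¹]` (★ `weylInvariants_glWeylGroup_eq_adjoin`)
and the generators take the values `z + z⁻¹`, `1`, `1`. [cite: CartierCorvallis1979, §IV.2 Example, Thm. 4.1] [cite: Rogawski1990, §4.11 Prop. 4.11.1 p. 59] -/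
theorem symmLaurent_line_even_two {P : AddMonoidAlgebra ℂ (Fin 2 → ℤ)}
    (hP : P ∈ weylInvariants ℂ (Fin 2 → ℤ) (ConnectedReductiveGroupData.glWeylGroup 2)) :
    ∃ Q : ℂ[X], ∀ z : ℂˣ, laurentEvalAt ![z, z⁻¹] P = Q.eval ((z : ℂ) + (z : ℂ)⁻¹) := by
  rw [weylInvariants_glWeylGroup_eq_adjoin 2 ℂ] at hP
  induction hP using Algebra.adjoin_induction with
  | mem x hx =>
    rcases hx with rfl | ⟨r, rfl⟩
    · exact ⟨1, fun z => by rw [laurentEvalAt_lineTwo_single, eval_one, sub_self, zpow_zero, mul_one]⟩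
    · exact exists_polynomial_laurentEvalAt_lineTwo_esymm r
  | algebraMap r => exact ⟨C r, fun z => by rw [AlgHom.commutes, eval_C]; rfl⟩
  | add x y _ _ hx hy =>
    obtain ⟨Q, hQ⟩ := hx
    obtain ⟨Q', hQ'⟩ := hy
    exact ⟨Q + Q', fun z => by rw [map_add, hQ z, hQ' z, eval_add]⟩
  | mul x y _ _ hx hy =>
    obtain ⟨Q, hQ⟩ := hx
    obtain ⟨Q', hQ'⟩ := hy
    exact ⟨Q * Q', fun z => by rw [map_mul, hQ z, hQ' z, eval_mul]⟩

/-- **`∃!` form**: the polynomial `Q` with `P(z, z⁻¹) = Q(z + z⁻¹)` is unique (`z + z⁻¹` exhausts `ℂ`, ★ `polynomial_eq_of_forall_eval_add_inv_eq`).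
[cite: CartierCorvallis1979, §IV.2 Example, Thm. 4.1, Cor. 4.2] -/
theorem symmLaurent_line_existsUnique_two {P : AddMonoidAlgebra ℂ (Fin 2 → ℤ)}
    (hP : P ∈ weylInvariants ℂ (Fin 2 → ℤ) (ConnectedReductiveGroupData.glWeylGroup 2)) :
    ∃! Q : ℂ[X], ∀ z : ℂˣ, laurentEvalAt ![z, z⁻¹] P = Q.eval ((z : ℂ) + (z : ℂ)⁻¹) := by
  obtain ⟨Q, hQ⟩ := symmLaurent_line_even_two hP
  exact ⟨Q, hQ, fun Q' hQ' => polynomial_eq_of_forall_eval_add_inv_eq fun z => (hQ' z).symm.trans (hQ z)⟩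

/-- **Evenness under `z ↦ z⁻¹`** (the transposition `(0 1) = S₂` acts on the line by `z ↦ z⁻¹`): `P(z⁻¹, z) = P(z, z⁻¹)` for `P ∈ ℂ[ℤ²]^{S₂}`.
[cite: CartierCorvallis1979, §IV.2 Example] -/
theorem laurentEvalAt_lineTwo_inv {P : AddMonoidAlgebra ℂ (Fin 2 → ℤ)}
    (hP : P ∈ weylInvariants ℂ (Fin 2 → ℤ) (ConnectedReductiveGroupData.glWeylGroup 2)) (z : ℂˣ) :
    laurentEvalAt ![z⁻¹, z] P = laurentEvalAt ![z, z⁻¹] P := by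
  obtain ⟨Q, hQ⟩ := symmLaurent_line_even_two hP
  have h := hQ z⁻¹
  rw [inv_inv] at h
  rw [h, hQ z, Units.val_inv_eq_inv_val, inv_inv, add_comm]

/-! ## §3 The unramified Hecke eigen-polynomials of `GL₂` in the unitary normalisation are even on the twisted line -/

section GLTwo

open scoped MatrixGroups
open ValuativeRel

universe u

variable {K : Type u} [Field K] [ValuativeRel K] [IsDiscreteValuationRing 𝒪[K]] [Finite 𝓀[K]] {ϖ : K}
  [IsHeckeTriple (⊤ : Submonoid (GL (Fin 2) K)) (glInt 2 K) (glInt 2 K)]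

/-- **W10-a (E.5) for `GL₂` — `λ^{GL₂}_{(z,z⁻¹)}(φ) = Q_φ(z + z⁻¹)`.**  For a non-archimedean field `K` (DVR valuation ring, finite residue
field of cardinality `q`, uniformizer `ϖ`; `(GL₂(K), GL₂(𝒪))` a Hecke pair — ★ `isHeckeTriple_glInt_of_finite_residueField`), a unit square root `u`
of `q` and the `δ_B^{1∕2}` Satake weight `wt(e) = u^{|e| − 2⟨ν, e⟩}` (the UNITARY normalisation, ★ `satakeTransform_deltaHalf_mem_weylInvariants (n := 2)`),
every `φ ∈ ℋ(GL₂(K), GL₂(𝒪))` has an eigen-polynomial `Q_φ ∈ ℂ[X]` on the twisted line: `λ_{(z, z⁻¹)}(φ) = Q_φ(z + z⁻¹)` for all `z ∈ ℂˣ`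
(`λ_{zz} = ev_{zz} ∘ 𝒮_{δ^{1∕2}}`, `𝒮_{δ^{1∕2}}(φ) ∈ ℂ[ℤ²]^{S₂}`, and `symmLaurent_line_even_two`).  This is the `GL₂`-input of the rank-2 η̂-graph
`GraphEta₁²` (print: the parameter `(z, z⁻¹)` of `χ_z ∘ N`, Prop. 4.11.1). [cite: CartierCorvallis1979, §IV (4.2)–(4.4), Thm. 4.1]
[cite: Rogawski1990, §4.11 Prop. 4.11.1 pp. 58–59] -/
theorem glTwoHeckeEigenpoly_line_even (hϖ : IsUniformizingElement ϖ) {u : ℂˣ}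
    (hu : (u : ℂ) ^ 2 = ((Nat.card 𝓀[K] : ℕ) : ℂ)) {wt : Multiplicative (Fin 2 → ℤ) →* ℂ}
    (hwt : ∀ e : Fin 2 → ℤ,
      wt (Multiplicative.ofAdd e) = ((u ^ ((((2 : ℕ) : ℤ) - 1) * (∑ i, e i) - 2 * satakeTwistExp e) : ℂˣ) : ℂ))
    (φ : heckeAlgebra ℂ (GL (Fin 2) K) (glInt 2 K)) :
    ∃ Q : ℂ[X], ∀ z : ℂˣ,
      (isIwasawaExponent_gl (n := 2) hϖ).heckeEigencharacter wt (laurentMonomialHom ![z, z⁻¹]) φ =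
        Q.eval ((z : ℂ) + (z : ℂ)⁻¹) :=
  symmLaurent_line_even_two (satakeTransform_deltaHalf_mem_weylInvariants (n := 2) hϖ hu hwt φ)

/-- **Uniqueness of the `GL₂` eigen-polynomial on the twisted line.** [cite: CartierCorvallis1979, §IV Cor. 4.2] -/
theorem glTwoHeckeEigenpoly_line_existsUnique (hϖ : IsUniformizingElement ϖ) {u : ℂˣ}
    (hu : (u : ℂ) ^ 2 = ((Nat.card 𝓀[K] : ℕ) : ℂ)) {wt : Multiplicative (Fin 2 → ℤ) →* ℂ}
    (hwt : ∀ e : Fin 2 → ℤ,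
      wt (Multiplicative.ofAdd e) = ((u ^ ((((2 : ℕ) : ℤ) - 1) * (∑ i, e i) - 2 * satakeTwistExp e) : ℂˣ) : ℂ))
    (φ : heckeAlgebra ℂ (GL (Fin 2) K) (glInt 2 K)) :
    ∃! Q : ℂ[X], ∀ z : ℂˣ,
      (isIwasawaExponent_gl (n := 2) hϖ).heckeEigencharacter wt (laurentMonomialHom ![z, z⁻¹]) φ =
        Q.eval ((z : ℂ) + (z : ℂ)⁻¹) :=
  symmLaurent_line_existsUnique_two (satakeTransform_deltaHalf_mem_weylInvariants (n := 2) hϖ hu hwt φ)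

/-- **The `GL₂` eigencharacters on the twisted line are even under `z ↦ z⁻¹`** (`S₂`-invariance of `𝒮_{δ^{1∕2}}(φ)`; the choice `(z, z⁻¹)` vs
`(z⁻¹, z)` is immaterial). [cite: CartierCorvallis1979, §IV Thm. 4.1] [cite: Rogawski1990, §4.11 p. 59] -/
theorem glTwoHeckeEigencharacter_line_inv (hϖ : IsUniformizingElement ϖ) {u : ℂˣ}
    (hu : (u : ℂ) ^ 2 = ((Nat.card 𝓀[K] : ℕ) : ℂ)) {wt : Multiplicative (Fin 2 → ℤ) →* ℂ}
    (hwt : ∀ e : Fin 2 → ℤ,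
      wt (Multiplicative.ofAdd e) = ((u ^ ((((2 : ℕ) : ℤ) - 1) * (∑ i, e i) - 2 * satakeTwistExp e) : ℂˣ) : ℂ))
    (φ : heckeAlgebra ℂ (GL (Fin 2) K) (glInt 2 K)) (z : ℂˣ) :
    (isIwasawaExponent_gl (n := 2) hϖ).heckeEigencharacter wt (laurentMonomialHom ![z⁻¹, z]) φ =
      (isIwasawaExponent_gl (n := 2) hϖ).heckeEigencharacter wt (laurentMonomialHom ![z, z⁻¹]) φ :=
  laurentEvalAt_lineTwo_inv (satakeTransform_deltaHalf_mem_weylInvariants (n := 2) hϖ hu hwt φ) z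

end GLTwo

end Summit.HodgeConjecture.HodgeConjecture.R90.S6

end
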